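import Literature.AlgebraicGeometry.Motives.RestrictScalarsBettiNaturality
import HarnessLib

/-!
# `Aut(ℂ/k)` permutes the components of `Hⁱ(Z|_k(ℂ); ℚ) ≅ ∏_σ Hⁱ(Z_σ(ℂ); ℚ)`

Layer `Literature/AlgebraicGeometry/Motives`, complement to `RestrictScalarsBetti` and
`RestrictScalarsBettiNaturality`. For a `K`-scheme `Z` regarded over a subfield `k ⊆ K`
(`[K : k] < ∞`), the complex points `Z|_k(ℂ)` are the disjoint union of the pieces
`{P | σ_P = σ} ≃ₜ Z_σ(ℂ)` over the `k`-embeddings `σ : K → ℂ`, and a `k`-automorphism `τ` of `ℂ`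
acting on `Z|_k(ℂ)` by `P ↦ τ • P = Spec τ ≫ P` carries the piece of `σ` onto the piece of
`τ ∘ σ` (`AlgPoints.embOfPoint_smul`). For `k = ℚ` and `τ` = complex conjugation this is how the
infinite Frobenius `F_∞` of a `ℚ`-scheme cut out of a variety over a number field permutes the
conjugate components (Deninger–Scholl 1991, (2.2) with §4.1: `M_n ⊗ ℂ` is the disjoint union of
`φ(n)` copies of `Γ(n)∖ℍ`, permuted by complex conjugation). This file records it on points and on
Betti cohomology, for a CONTINUOUS `τ` (only then is `P ↦ τ • P` continuous for the analytic
topology, `AlgPoints.continuous_smul_algEquiv`):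

* `AlgPoints.continuous_algEquiv_symm` — a continuous `τ ∈ Aut(ℂ/k)` has a continuous inverse
  (it is the identity or complex conjugation, `Complex.ringHom_eq_id_or_conj_of_continuous`);
  `AlgPoints.smulContinuous X τ hτ : C(X(ℂ), X(ℂ))` — its action on complex points;
* `conjPieceHomeomorph Z σ τ hτ : Z_σ(ℂ) ≃ₜ Z_{τσ}(ℂ)` — the homeomorphism of components induced
  by `τ` (through the pieces of `Z|_k(ℂ)`), with `pieceIncl_comp_conjPieceHomeomorph`
  (`ι_{τσ} ∘ h = (τ • ·) ∘ ι_σ`) and its naturality in `Z`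
  (`conjPieceHomeomorph_comp_mapContinuous_baseChangeHom`: `h ∘ φ_σ(ℂ) = φ_{τσ}(ℂ) ∘ h`;
  on cohomology `map_conjPieceHomeomorph_map_baseChangeHom`);
* `bettiCohomologyRestrictScalarsEquiv_map_smulContinuous` — **on cohomology**: the
  `σ`-component of `(τ • ·)* z` is `h*` of the `τσ`-component of `z`.

Everything is proved; no named facts (D-0014).

## References

* C. Deninger, A. J. Scholl, *The Beilinson conjectures*, LMS LNS 153 (1991), (2.2), §4.1.
  [DeningerScholl1991]
* A. Hatcher, *Algebraic Topology*, CUP 2002, §3.1 (functoriality of singular cohomology).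
  [HatcherAT2002]
-/

noncomputable section

open CategoryTheory Topology AlgebraicGeometry

namespace Literature.AlgebraicGeometry.Motives

open Literature.AlgebraicTopology.SingularHomology

/-! ### The action of a continuous `τ ∈ Aut(ℂ/k)` on complex points, as a continuous map -/

namespace AlgPoints

variable {k : Type} [Field k] [Algebra k ℂ] {X Y : SchemeOver k}

/-- A continuous `k`-automorphism of `ℂ` has a continuous inverse: by
`Complex.ringHom_eq_id_or_conj_of_continuous` it is the identity or complex conjugation, both
involutions. [folklore] -/
theorem continuous_algEquiv_symm (τ : ℂ ≃ₐ[k] ℂ) (hτ : Continuous τ) :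
    Continuous (τ⁻¹ : ℂ ≃ₐ[k] ℂ) := by
  have key : ∀ z, (τ⁻¹ : ℂ ≃ₐ[k] ℂ) z = τ z := by
    intro z
    apply τ.injective
    change τ (τ.symm z) = τ (τ z)
    rw [τ.apply_symm_apply]
    rcases Complex.ringHom_eq_id_or_conj_of_continuous (f := (τ : ℂ →+* ℂ)) hτ with h | h
    · have h1 : ∀ w, τ w = w := fun w => RingHom.congr_fun h w
      rw [h1, h1]
    · have h1 : ∀ w, τ w = (starRingEnd ℂ) w := fun w => RingHom.congr_fun h w
      rw [h1, h1, Complex.conj_conj]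
  exact hτ.congr fun z => (key z).symm

variable (X) in
/-- The action `P ↦ τ • P` of a continuous `k`-automorphism `τ` of `ℂ` on `X(ℂ)`, as a bundled
continuous map (`continuous_smul_algEquiv`; e.g. complex conjugation for `k ⊆ ℝ`). [folklore] -/
def smulContinuous (τ : ℂ ≃ₐ[k] ℂ) (hτ : Continuous τ) : C(ComplexPoints X, ComplexPoints X) :=
  ⟨fun P => τ • P, continuous_smul_algEquiv τ hτ⟩

/-- `smulContinuous τ hτ P = τ • P`. [folklore] -/
@[simp]
theorem smulContinuous_apply (τ : ℂ ≃ₐ[k] ℂ) (hτ : Continuous τ) (P : ComplexPoints X) :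
    smulContinuous X τ hτ P = τ • P :=
  rfl

/-- `P ↦ τ • P` commutes with the maps induced by `k`-morphisms (`map_smul`). [folklore] -/
theorem smulContinuous_comp_mapContinuous (τ : ℂ ≃ₐ[k] ℂ) (hτ : Continuous τ) (φ : X ⟶ Y) :
    (smulContinuous Y τ hτ).comp (mapContinuous (L := ℂ) φ) =
      (mapContinuous (L := ℂ) φ).comp (smulContinuous X τ hτ) := by
  ext P : 1
  simp [map_smul]

end AlgPoints

/-! ### `τ` carries the component `Z_σ(ℂ)` onto the component `Z_{τσ}(ℂ)` -/

section Pieces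

variable {k : Type} [Field k] [Algebra k ℂ] {K : Type} [Field K] [Algebra k K] (Z : SchemeOver K)
  {Z' : SchemeOver K}

/-- `τ • P` lies in the piece of `τ ∘ σ` when `P` lies in the piece of `σ`
(`AlgPoints.embOfPoint_smul`). [folklore] -/
theorem embOfPoint_smul_eq_comp {σ : K →ₐ[k] ℂ} (τ : ℂ ≃ₐ[k] ℂ)
    {P : ComplexPoints (Z.restrictScalars k)} (hP : AlgPoints.embOfPoint Z P = σ) :
    AlgPoints.embOfPoint Z (τ • P) = (τ : ℂ →ₐ[k] ℂ).comp σ := by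
  rw [AlgPoints.embOfPoint_smul, hP]

/-- `τ⁻¹ • P` lies in the piece of `σ` when `P` lies in the piece of `τ ∘ σ`. [folklore] -/
theorem embOfPoint_inv_smul_eq {σ : K →ₐ[k] ℂ} (τ : ℂ ≃ₐ[k] ℂ)
    {P : ComplexPoints (Z.restrictScalars k)}
    (hP : AlgPoints.embOfPoint Z P = (τ : ℂ →ₐ[k] ℂ).comp σ) :
    AlgPoints.embOfPoint Z (τ⁻¹ • P) = σ := by
  rw [AlgPoints.embOfPoint_smul, hP]
  ext a
  change τ⁻¹ (τ (σ a)) = σ a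
  exact τ.symm_apply_apply (σ a)

/-- **The homeomorphism of components induced by `τ ∈ Aut(ℂ/k)`**:
`h_{σ,τ} : Z_σ(ℂ) ≃ₜ Z_{τσ}(ℂ)`, `Q ↦` the point of `Z_{τσ}(ℂ)` corresponding to `τ • ι_σ(Q)` in
the piece of `τ ∘ σ` (for `τ` = complex conjugation: the anti-holomorphic identification of the
conjugate components `W_σ(ℂ) ≃ W_σ̄(ℂ)`, Deninger–Scholl (2.2), §4.1).
[cite: DeningerScholl1991, (2.2) and §4.1] -/
def conjPieceHomeomorph (σ : K →ₐ[k] ℂ) (τ : ℂ ≃ₐ[k] ℂ) (hτ : Continuous τ) :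
    ComplexPoints ((baseChangeHom σ.toRingHom).obj Z) ≃ₜ
      ComplexPoints ((baseChangeHom ((τ : ℂ →ₐ[k] ℂ).comp σ).toRingHom).obj Z) where
  toFun Q := (pieceHomeomorphBaseChange Z ((τ : ℂ →ₐ[k] ℂ).comp σ)).symm
    ⟨τ • (pieceHomeomorphBaseChange Z σ Q).1,
      embOfPoint_smul_eq_comp Z τ (pieceHomeomorphBaseChange Z σ Q).2⟩
  invFun R := (pieceHomeomorphBaseChange Z σ).symm
    ⟨τ⁻¹ • (pieceHomeomorphBaseChange Z ((τ : ℂ →ₐ[k] ℂ).comp σ) R).1,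
      embOfPoint_inv_smul_eq Z τ (pieceHomeomorphBaseChange Z ((τ : ℂ →ₐ[k] ℂ).comp σ) R).2⟩
  left_inv Q := by
    apply (pieceHomeomorphBaseChange Z σ).injective
    rw [Homeomorph.apply_symm_apply]
    apply Subtype.ext
    simp only [Homeomorph.apply_symm_apply, inv_smul_smul]
  right_inv R := by
    apply (pieceHomeomorphBaseChange Z ((τ : ℂ →ₐ[k] ℂ).comp σ)).injective
    rw [Homeomorph.apply_symm_apply]
    apply Subtype.ext
    simp only [Homeomorph.apply_symm_apply, smul_inv_smul]
  continuous_toFun :=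
    (pieceHomeomorphBaseChange Z _).symm.continuous.comp
      ((((AlgPoints.continuous_smul_algEquiv τ hτ).comp continuous_subtype_val).comp
        (pieceHomeomorphBaseChange Z σ).continuous).subtype_mk _)
  continuous_invFun :=
    (pieceHomeomorphBaseChange Z σ).symm.continuous.comp
      ((((AlgPoints.continuous_smul_algEquiv τ⁻¹
        (AlgPoints.continuous_algEquiv_symm τ hτ)).comp continuous_subtype_val).comp
        (pieceHomeomorphBaseChange Z _).continuous).subtype_mk _)

/-- Pointwise form of the defining property: `ι_{τσ} (h Q) = τ • ι_σ Q` in `Z|_k(ℂ)`. [folklore] -/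
theorem pieceIncl_conjPieceHomeomorph_apply (σ : K →ₐ[k] ℂ) (τ : ℂ ≃ₐ[k] ℂ) (hτ : Continuous τ)
    (Q : ComplexPoints ((baseChangeHom σ.toRingHom).obj Z)) :
    ((pieceHomeomorphBaseChange Z ((τ : ℂ →ₐ[k] ℂ).comp σ) (conjPieceHomeomorph Z σ τ hτ Q) :
        {P : ComplexPoints (Z.restrictScalars k) //
          AlgPoints.embOfPoint Z P = (τ : ℂ →ₐ[k] ℂ).comp σ}) :
      ComplexPoints (Z.restrictScalars k)) =
      τ • ((pieceHomeomorphBaseChange Z σ Q : {P : ComplexPoints (Z.restrictScalars k) //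
        AlgPoints.embOfPoint Z P = σ}) : ComplexPoints (Z.restrictScalars k)) := by
  change ((pieceHomeomorphBaseChange Z ((τ : ℂ →ₐ[k] ℂ).comp σ))
      ((pieceHomeomorphBaseChange Z ((τ : ℂ →ₐ[k] ℂ).comp σ)).symm _)).1 = τ • _
  rw [Homeomorph.apply_symm_apply]

/-- **`ι_{τσ} ∘ h_{σ,τ} = (τ • ·) ∘ ι_σ`**: the homeomorphism of components covers the action of `τ`
on `Z|_k(ℂ)` (by construction). [folklore] -/
theorem pieceIncl_comp_conjPieceHomeomorph (σ : K →ₐ[k] ℂ) (τ : ℂ ≃ₐ[k] ℂ) (hτ : Continuous τ) :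
    ((subsetIncl {P : ComplexPoints (Z.restrictScalars k) |
          AlgPoints.embOfPoint Z P = (τ : ℂ →ₐ[k] ℂ).comp σ}).comp
        (pieceHomeomorphBaseChange Z ((τ : ℂ →ₐ[k] ℂ).comp σ) :
          C(ComplexPoints ((baseChangeHom ((τ : ℂ →ₐ[k] ℂ).comp σ).toRingHom).obj Z),
            {P : ComplexPoints (Z.restrictScalars k) //
              AlgPoints.embOfPoint Z P = (τ : ℂ →ₐ[k] ℂ).comp σ}))).comp
      (conjPieceHomeomorph Z σ τ hτ :
        C(ComplexPoints ((baseChangeHom σ.toRingHom).obj Z),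
          ComplexPoints ((baseChangeHom ((τ : ℂ →ₐ[k] ℂ).comp σ).toRingHom).obj Z))) =
    (AlgPoints.smulContinuous (Z.restrictScalars k) τ hτ).comp
      ((subsetIncl {P : ComplexPoints (Z.restrictScalars k) | AlgPoints.embOfPoint Z P = σ}).comp
        (pieceHomeomorphBaseChange Z σ : C(ComplexPoints ((baseChangeHom σ.toRingHom).obj Z),
          {P : ComplexPoints (Z.restrictScalars k) // AlgPoints.embOfPoint Z P = σ}))) := by
  ext Q : 1
  exact pieceIncl_conjPieceHomeomorph_apply Z σ τ hτ Q

/-- The inclusion `Z_σ(ℂ) → Z|_k(ℂ)` of a component is injective. [folklore] -/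
theorem pieceIncl_injective (σ : K →ₐ[k] ℂ) :
    Function.Injective fun Q : ComplexPoints ((baseChangeHom σ.toRingHom).obj Z) =>
      ((pieceHomeomorphBaseChange Z σ Q : {P : ComplexPoints (Z.restrictScalars k) //
        AlgPoints.embOfPoint Z P = σ}) : ComplexPoints (Z.restrictScalars k)) :=
  Subtype.val_injective.comp (pieceHomeomorphBaseChange Z σ).injective

/-- Pointwise naturality of the piece inclusions (from
`pieceIncl_comp_mapContinuous_baseChangeHom`): `ι'_σ (φ_σ Q) = φ|_k (ι_σ Q)`. [folklore] -/
theorem pieceIncl_mapContinuous_baseChangeHom_apply (φ : Z ⟶ Z') (σ : K →ₐ[k] ℂ)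
    (Q : ComplexPoints ((baseChangeHom σ.toRingHom).obj Z)) :
    ((pieceHomeomorphBaseChange Z' σ
        (AlgPoints.mapContinuous (L := ℂ) ((baseChangeHom σ.toRingHom).map φ) Q) :
          {P : ComplexPoints (Z'.restrictScalars k) // AlgPoints.embOfPoint Z' P = σ}) :
        ComplexPoints (Z'.restrictScalars k)) =
      AlgPoints.mapContinuous (L := ℂ)
        ((Over.map (Spec.map (CommRingCat.ofHom (algebraMap k K)))).map φ)
        ((pieceHomeomorphBaseChange Z σ Q : {P : ComplexPoints (Z.restrictScalars k) //
          AlgPoints.embOfPoint Z P = σ}) : ComplexPoints (Z.restrictScalars k)) :=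
  DFunLike.congr_fun (pieceIncl_comp_mapContinuous_baseChangeHom (k := k) φ σ) Q

/-- **`h_{σ,τ}` is natural in `Z`**: for a `K`-morphism `φ : Z ⟶ Z'`,
`h^{Z'} ∘ φ_σ(ℂ) = φ_{τσ}(ℂ) ∘ h^Z` (both are covered by `(τ • ·) ∘ φ|_k(ℂ) = φ|_k(ℂ) ∘ (τ • ·)` on
`Z|_k(ℂ)`, `AlgPoints.map_smul`, and the piece inclusions are injective). [folklore] -/
theorem conjPieceHomeomorph_comp_mapContinuous_baseChangeHom (φ : Z ⟶ Z') (σ : K →ₐ[k] ℂ)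
    (τ : ℂ ≃ₐ[k] ℂ) (hτ : Continuous τ) :
    (conjPieceHomeomorph Z' σ τ hτ :
        C(ComplexPoints ((baseChangeHom σ.toRingHom).obj Z'),
          ComplexPoints ((baseChangeHom ((τ : ℂ →ₐ[k] ℂ).comp σ).toRingHom).obj Z'))).comp
        (AlgPoints.mapContinuous (L := ℂ) ((baseChangeHom σ.toRingHom).map φ)) =
      (AlgPoints.mapContinuous (L := ℂ)
          ((baseChangeHom ((τ : ℂ →ₐ[k] ℂ).comp σ).toRingHom).map φ)).comp
        (conjPieceHomeomorph Z σ τ hτ :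
          C(ComplexPoints ((baseChangeHom σ.toRingHom).obj Z),
            ComplexPoints ((baseChangeHom ((τ : ℂ →ₐ[k] ℂ).comp σ).toRingHom).obj Z))) := by
  ext Q : 1
  apply pieceIncl_injective Z' ((τ : ℂ →ₐ[k] ℂ).comp σ)
  dsimp only
  rw [ContinuousMap.comp_apply, ContinuousMap.comp_apply, ContinuousMap.coe_coe,
    ContinuousMap.coe_coe, pieceIncl_conjPieceHomeomorph_apply,
    pieceIncl_mapContinuous_baseChangeHom_apply, pieceIncl_mapContinuous_baseChangeHom_apply,
    pieceIncl_conjPieceHomeomorph_apply, AlgPoints.mapContinuous_apply,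
    AlgPoints.mapContinuous_apply, AlgPoints.map_smul]

end Pieces

/-! ### On Betti cohomology -/

section Cohomology

variable {k : Type} [Field k] [Algebra k ℂ] {K : Type} [Field K] [Algebra k K] (Z : SchemeOver K)

/-- `h_{σ,τ}*` intertwines the pull-backs along a `K`-morphism `φ` on the components:
`h* ∘ (φ_{τσ})* = (φ_σ)* ∘ h*` (from `conjPieceHomeomorph_comp_mapContinuous_baseChangeHom`).
[cite: HatcherAT2002, §3.1] -/
theorem map_conjPieceHomeomorph_map_baseChangeHom {Z' : SchemeOver K} (φ : Z ⟶ Z')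
    (σ : K →ₐ[k] ℂ) (τ : ℂ ≃ₐ[k] ℂ) (hτ : Continuous τ) (i : ℕ)
    (y : bettiCohomology ((baseChangeHom ((τ : ℂ →ₐ[k] ℂ).comp σ).toRingHom).obj Z') i) :
    singularCohomology.map ℚ ℚ (conjPieceHomeomorph Z σ τ hτ :
          C(ComplexPoints ((baseChangeHom σ.toRingHom).obj Z),
            ComplexPoints ((baseChangeHom ((τ : ℂ →ₐ[k] ℂ).comp σ).toRingHom).obj Z))) i
        (bettiCohomology.map ((baseChangeHom ((τ : ℂ →ₐ[k] ℂ).comp σ).toRingHom).map φ) i y) =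
      bettiCohomology.map ((baseChangeHom σ.toRingHom).map φ) i
        (singularCohomology.map ℚ ℚ (conjPieceHomeomorph Z' σ τ hτ :
          C(ComplexPoints ((baseChangeHom σ.toRingHom).obj Z'),
            ComplexPoints ((baseChangeHom ((τ : ℂ →ₐ[k] ℂ).comp σ).toRingHom).obj Z'))) i y) := by
  have h := singularCohomology.map_comp ℚ ℚ
    (conjPieceHomeomorph Z σ τ hτ :
      C(ComplexPoints ((baseChangeHom σ.toRingHom).obj Z),
        ComplexPoints ((baseChangeHom ((τ : ℂ →ₐ[k] ℂ).comp σ).toRingHom).obj Z)))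
    (AlgPoints.mapContinuous (L := ℂ)
      ((baseChangeHom ((τ : ℂ →ₐ[k] ℂ).comp σ).toRingHom).map φ)) i
  have h' := singularCohomology.map_comp ℚ ℚ
    (AlgPoints.mapContinuous (L := ℂ) ((baseChangeHom σ.toRingHom).map φ))
    (conjPieceHomeomorph Z' σ τ hτ :
      C(ComplexPoints ((baseChangeHom σ.toRingHom).obj Z'),
        ComplexPoints ((baseChangeHom ((τ : ℂ →ₐ[k] ℂ).comp σ).toRingHom).obj Z'))) i
  rw [conjPieceHomeomorph_comp_mapContinuous_baseChangeHom, h] at h'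
  exact LinearMap.congr_fun (ModuleCat.hom_ext_iff.mp h') y

variable [FiniteDimensional k K]

/-- **`Aut(ℂ/k)` permutes the components of `Hⁱ(Z|_k(ℂ); ℚ) ≅ ∏_σ Hⁱ(Z_σ(ℂ); ℚ)`**: for a
continuous `k`-automorphism `τ` of `ℂ`, the `σ`-component of `(τ • ·)* z` is `h_{σ,τ}*` of the
`τσ`-component of `z` (for `k = ℚ`, `τ` = complex conjugation: the infinite Frobenius `F_∞` of
Deninger–Scholl (2.2) carries the `σ̄`-component to the `σ`-component).
[cite: DeningerScholl1991, (2.2) and §4.1] -/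
theorem bettiCohomologyRestrictScalarsEquiv_map_smulContinuous (τ : ℂ ≃ₐ[k] ℂ) (hτ : Continuous τ)
    (i : ℕ) (z : bettiCohomology (Z.restrictScalars k) i) (σ : K →ₐ[k] ℂ) :
    bettiCohomologyRestrictScalarsEquiv Z i
        (singularCohomology.map ℚ ℚ (AlgPoints.smulContinuous (Z.restrictScalars k) τ hτ) i z) σ =
      singularCohomology.map ℚ ℚ (conjPieceHomeomorph Z σ τ hτ :
          C(ComplexPoints ((baseChangeHom σ.toRingHom).obj Z),
            ComplexPoints ((baseChangeHom ((τ : ℂ →ₐ[k] ℂ).comp σ).toRingHom).obj Z))) i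
        (bettiCohomologyRestrictScalarsEquiv Z i z ((τ : ℂ →ₐ[k] ℂ).comp σ)) := by
  rw [bettiCohomologyRestrictScalarsEquiv_apply, bettiCohomologyRestrictScalarsEquiv_apply]
  have h := singularCohomology.map_comp ℚ ℚ
    ((subsetIncl {P : ComplexPoints (Z.restrictScalars k) | AlgPoints.embOfPoint Z P = σ}).comp
      (pieceHomeomorphBaseChange Z σ : C(ComplexPoints ((baseChangeHom σ.toRingHom).obj Z),
        {P : ComplexPoints (Z.restrictScalars k) // AlgPoints.embOfPoint Z P = σ})))
    (AlgPoints.smulContinuous (Z.restrictScalars k) τ hτ) i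
  have h' := singularCohomology.map_comp ℚ ℚ
    (conjPieceHomeomorph Z σ τ hτ :
      C(ComplexPoints ((baseChangeHom σ.toRingHom).obj Z),
        ComplexPoints ((baseChangeHom ((τ : ℂ →ₐ[k] ℂ).comp σ).toRingHom).obj Z)))
    ((subsetIncl {P : ComplexPoints (Z.restrictScalars k) |
          AlgPoints.embOfPoint Z P = (τ : ℂ →ₐ[k] ℂ).comp σ}).comp
      (pieceHomeomorphBaseChange Z ((τ : ℂ →ₐ[k] ℂ).comp σ) :
        C(ComplexPoints ((baseChangeHom ((τ : ℂ →ₐ[k] ℂ).comp σ).toRingHom).obj Z),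
          {P : ComplexPoints (Z.restrictScalars k) //
            AlgPoints.embOfPoint Z P = (τ : ℂ →ₐ[k] ℂ).comp σ}))) i
  rw [pieceIncl_comp_conjPieceHomeomorph, h] at h'
  exact LinearMap.congr_fun (ModuleCat.hom_ext_iff.mp h') z

end Cohomology

end Literature.AlgebraicGeometry.Motives

end
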